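import Summits.QuantumFields.YangMills.Theorems.FluctuationComparisonRegPrIntLOrganTangentAPackageDescendTo
import Summits.QuantumFields.YangMills.Theorems.FluctuationComparisonRegPrIntLClassicalPerHeightSteps
import HarnessLib

/-!
# `FluctuationComparisonRegPrIntLS1aTowerLawSandwich` — THE S1aᴴ TOWER LAWS ARE SANDWICHED BY DESCENDED GIBBS MEASURES:
# (w) BY NAME AT THE UNCUT HEIGHTS, `Z_K⁻¹ρ^{E}_{K−j}·dU ≤ μ_j ≤ ν_{K,j}` AT EVERY HEIGHT, AND (m3)'s TRANSFER IN THE NAMED CURRENCY (the a.e. density sandwich)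

Cell `ym3-torus` (YM ladder rung R3 = continuum `SU(2)` Yang–Mills on T³ — NOT d = 4, NOT infinite volume, NOT a mass gap, NOT Clay); width seat
`ym3-torus-px21` (gen 22), WIDTH COPY of ★p1 «CMP 102 Thm 1's inputs AS PRINTED vs AS TYPED, every gap named».  Helper of the crux
`stmt-QuantumFields-20520` `FluctuationComparisonRegPrIntL` (`--kind proof --supports … --as helper`, count-neutral).  THEOREMS ONLY: definition-free,
default heartbeats, no `instance`∕`notation`.  FILE A of two (FILE B `…S1aTowerDensityVersion`: (p) ∧ (w) for ONE version via WREG).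

WHAT.  The live line `Lines/runpair_organ.lean` (v18.4) carries the UV-stability stub S1aᴴ `RunClassMembershipH` (:534); for the RUNS `ν` (`ν K K = Gibbs_K`,
`ν K j = (descend F ℰp j)_* ν K (j+1)`) and the CUT TOWERS `μ` (`μ j = ν K j` for `Ts ≤ j`, `μ j = (descend F ℰp j)_*((μ (j+1)).withDensity (χ (j+1)))` for `j < Ts`;
the line's weight is `χ i = ofReal ∘ sfCut (θBal F.L γ b₀ p₀ i)`) it asks, per height `j`, a density `ρ_j` with (p) window positivity, (w) `μ j = dU_j.withDensity (ofReal ∘ ρ_j)`,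
(m) class membership, (c) window continuity, (a) analyticity.  HOME UV3-NODE §67.3 (px20 g20) lists (w), (p) and the cut-tower restatement (m3) as «S, tree technology,
unassigned».  This file types and proves the measure-level facts behind them, with the cut weight ABSTRACT (any measurable `χ i : GaugeField (F.P i) 0 SU(2) → ℝ≥0∞`,
`χ ≤ 1`; the line's `sfCut` is one instance — `sfCut_nonneg ∕ sfCut_le_one ∕ measurable_sfCut` and the plateau `PlaqSmall (θ∕2) ⟹ sfCut θ = 1` are the consumer's one-liners):
* §1 ★`run_eq_map_descendTo`: `ν K j = (descendTo F ℰp j K)_* Gibbs_K` (`j ≤ K`); ★★`run_eq_withDensity_heightDensity_univ`: `ν K j = dU_j.withDensity (ofReal (Z_K⁻¹ ·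
  heightDensity F γ hjK univ))` (lit ✓`T3TiltDescent.map_descendTo_restrict_eq_withDensity` at `S = univ`) — (w) AT THE UNCUT HEIGHTS, BY NAME (§67.3 (w): «the identification
  is typed in pieces, not as this sentence» — now the sentence); probability; `≪ dU_j`.
* §2 ★`tower_le_run`: `μ j ≤ ν K j` (all `j`; `χ ≤ 1`; the importable twin of the line-internal `SFTower.sfTower_le_and_deficit` (1)); ★★`map_restrict_le_tower`: for every
  measurable `E` on run `K`'s finest fields with `χ i (descendTo F ℰp i K U) = 1` for `U ∈ E`, `j < i ≤ Ts`: `(descendTo F ℰp j K)_*(Gibbs_K|E) ≤ μ j`;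
  ★★`withDensity_heightDensity_le_tower`: the same in the NAMED currency `dU_j.withDensity (ofReal (Z_K⁻¹·heightDensity F γ hjK E)) ≤ μ j`; ★`tower_absolutelyContinuous`
  (⟹ (w) for the cut heights: a density EXISTS); `isFiniteMeasure_tower`.
* §3 `histGood_plateau` + ★★★`density_sandwich_ae`: with the plateau hypothesis `PlaqSmall (θ′ i) U ⟹ χ i U = 1` (`j < i ≤ Ts`; for `sfCut (θBal … b₀ …)` take
  `θ′ = θBal F.L γ (b₀∕2) p₀`) EVERY density `f` of `μ j` satisfies `ofReal (Z_K⁻¹·heightDensity … (histGood F ℰp θ′ K j)) ≤ f ≤ ofReal (Z_K⁻¹·heightDensity … univ)` `dU_j`-a.e.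
  — (m3) AS A SENTENCE: a (47)-type LOWER bound for the `histGood`-RESTRICTED renormalised density of run `K` (print's own object: the derivation of (47), p.267, restricts EVERY
  level by `χ_i`) and a (41)-type UPPER bound for the FULL density BOTH transfer a.e. to the cut tower's density; neither `Witness.lower` nor the (α)-socket's `Ineq47At`
  (both stated for the full density) is needed below `Ts` in any other form.

LOCATED RESIDUAL (★p1 «every gap named»; nothing below is asserted).  The sandwich pays (p) on the window of `θ′` (FILE B): for the cut heights `j < Ts` that is the HALF
window `b₀∕2` of S1aᴴ's `b₀`, while S1aᴴ's (p) names the FULL `θBal F.L γ b₀ p₀ j`-window; the annulus `θ_j∕2 ≤ maxₚ dist1 < θ_j` needs a fine history over `V` whose heights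
`(j, Ts]` lie where `sfCut > 0` (`PlaqSmall (24∕25·θ_i)`), i.e. lit ✓`T3SmallLiftHistory.exists_mem_fibre_histGood` with a one-step small lift of gain `κ√L < 24∕25` STRICT (the
tree's ✓`ApproxLift.AnsatzT.stub_oneStepSmallLift` states `κ√L ≤ 1`) plus fibre positivity there.  (m), (c), (a) of S1aᴴ are untouched (UV3-NODE §67.3∕67.7–67.9∕§69).

HONEST: measure-theoretic plumbing over landed kernel facts (lit `T3TiltDescent` §4, ✓(L16) `…OrganTangentAPackageDescendTo` §1, ✓`…ClassicalPerHeightSteps` §0); nothing of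
Bałaban's renormalisation-group analysis is asserted or proved; S1aᴴ ∕ `FirstExitWindowTailL` ∕ S2β ∕ `OrganDischargeInputsHJ` (undischarged) ∕ the five registered stubs of
`Lines/semiclassical_s2beta.lean` (3732b7df) ∕ crux 20520 ∕ 19936 ∕ 19200 ∕ `YM3TorusSU2` are NOT proved; registry untouched; rung R3 = SU(2) YM₃ on T³ at fixed lattice data —
NOT d = 4, NOT infinite volume, NOT a mass gap, NOT Clay; the Yang–Mills mass gap is NOT proved by any of this.
References: [Balaban1985UV3] CMP 102 (1985) (2) p. 256, (7) p. 257, (41) p. 266, (47) p. 267; [Balaban1987RG1] CMP 109 (1987) (0.4)∕(0.11) p. 253; [Balaban1985Averaging] CMP 98 (1985) (10) p. 19.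
-/

set_option autoImplicit false

noncomputable section

namespace Summit.QuantumFields.YangMills.Theorems.FluctuationComparisonRegPrIntLS1aTowerLawSandwich

open MeasureTheory Filter Topology Set Function
open scoped ENNReal NNReal
open Literature.MathematicalPhysics.QuantumFieldTheory.Balaban1983to89
open T3ContinuumYM3Torus T3NestedUnitLaws T3UnitLawDensityEML T3UnitScaleTilt T3LevelShift T3TiltDescent T4Continuum
open Literature.MathematicalPhysics.QuantumFieldTheory.Balaban1983to89.Missing
open Literature.MathematicalPhysics.QuantumFieldTheory.Balaban1983to89.T3DescentFibreTower (descendTo_descendTo descendTo_self)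
open scoped Literature.MathematicalPhysics.QuantumFieldTheory.Balaban1983to89.T3OrbitAverage
open Summit.QuantumFields.YangMills.Theorems.FluctuationComparisonRegPrIntLOrganTangentFibredChartDescendTo (descend_eq_descendTo')
open Summit.QuantumFields.YangMills.Theorems.FluctuationComparisonRegPrIntLOrganTangentAPackageDescendTo (absolutelyContinuous_map_descendTo)
open Summit.QuantumFields.YangMills.Theorems.FluctuationComparisonRegPrIntLClassicalPerHeightSteps (histGood_iff_descendTo)

/-! ## §0 Four measure-theoretic one-liners -/

section Abstract

variable {X Y : Type*} [MeasurableSpace X] [MeasurableSpace Y]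

/-- Push-forward of a pulled-back density: `(μ.withDensity (d ∘ T)).map T = (μ.map T).withDensity d` for measurable `T`, `d`. [folklore] -/
theorem map_withDensity_comp_eq {μ : Measure X} {T : X → Y} (hT : Measurable T) {d : Y → ℝ≥0∞} (hd : Measurable d) :
    (μ.withDensity fun x => d (T x)).map T = (μ.map T).withDensity d := by
  ext s hs
  rw [Measure.map_apply hT hs, withDensity_apply _ (hT hs), withDensity_apply _ hs, Measure.restrict_map hT hs, lintegral_map hd hT]

/-- `withDensity` is monotone in the measure. [folklore] -/
theorem withDensity_mono_measure {μ ν : Measure X} (h : μ ≤ ν) (f : X → ℝ≥0∞) : μ.withDensity f ≤ ν.withDensity f := by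
  refine Measure.le_iff.mpr fun s hs => ?_
  rw [withDensity_apply _ hs, withDensity_apply _ hs]
  exact lintegral_mono' (Measure.restrict_mono le_rfl h) le_rfl

/-- A weight equal to `1` on `E` does not change `μ|E`. [folklore] -/
theorem restrict_withDensity_eq_restrict_of_eq_one {μ : Measure X} {E : Set X} (hE : MeasurableSet E) {f : X → ℝ≥0∞}
    (hf : ∀ x ∈ E, f x = 1) : (μ.restrict E).withDensity f = μ.restrict E := by
  have h1 : f =ᵐ[μ.restrict E] (1 : X → ℝ≥0∞) := (ae_restrict_iff' hE).mpr (ae_of_all _ fun x hx => hf x hx)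
  rw [withDensity_congr_ae h1, withDensity_one]

/-- From `μ.withDensity f ≤ μ.withDensity g` to `f ≤ g` a.e. (`μ` σ-finite, `f` measurable). [folklore] -/
theorem ae_le_of_withDensity_le {μ : Measure X} [SigmaFinite μ] {f g : X → ℝ≥0∞} (hf : Measurable f)
    (h : μ.withDensity f ≤ μ.withDensity g) : f ≤ᵐ[μ] g := by
  refine ae_le_of_forall_setLIntegral_le_of_sigmaFinite hf fun s hs _ => ?_
  rw [← withDensity_apply _ hs, ← withDensity_apply _ hs]
  exact Measure.le_iff.mp h s hs

end Abstract

/-! ## §1 The runs ARE the descended Gibbs measures: (w) at the uncut heights, by name -/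

section Runs

variable (F : T3Family) {γ : ℝ}

/-- ★ **THE RUN LAW AT HEIGHT `j ≤ K` IS THE `(K−j)`-FOLD DESCENDED GIBBS MEASURE OF RUN `K`**: from S1aᴴ's two run hypotheses
(`ν K K = Gibbs_K`, `ν K j = (descend F ℰp j)_* ν K (j+1)` for `j < K`), `ν K j = (descendTo F ℰp j K)_* Gibbs_K` ([Balaban1987RG1] (0.11): `Ū^{k} = M^{k}(U)` across the
towers; ✓`descend_eq_descendTo'`, lit ✓`descendTo_descendTo`, ✓`descendTo_self`). [cite: Balaban1987RG1, (0.4) and (0.11) p.253] -/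
theorem run_eq_map_descendTo
    (ν : ℕ → (j : ℕ) → Measure (GaugeField (F.P j) 0 ↥(Matrix.specialUnitaryGroup (Fin 2) ℂ)))
    (hν1 : ∀ K, ν K K = T4GenFunBounds.gibbsMeasure (F.P K) ((F.scheme ℰp γ).β K))
    (hν2 : ∀ K j, j < K → ν K j = Measure.map (descend F ℰp j) (ν K (j + 1)))
    {j K : ℕ} (hjK : j ≤ K) :
    ν K j = Measure.map (descendTo F ℰp j K hjK) (gibbsK F ℰp γ K) := by
  -- induction on the depth `d = K − j`
  suffices h : ∀ (d j : ℕ) (hjK : j ≤ K), j + d = K → ν K j = Measure.map (descendTo F ℰp j K hjK) (gibbsK F ℰp γ K) from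
    h (K - j) j hjK (by omega)
  intro d
  induction d with
  | zero =>
    intro j hjK hj
    rw [add_zero] at hj
    subst hj
    have e : (descendTo F ℰp j j hjK : GaugeField (F.P j) 0 ↥(Matrix.specialUnitaryGroup (Fin 2) ℂ) →
        GaugeField (F.P j) 0 ↥(Matrix.specialUnitaryGroup (Fin 2) ℂ)) = id := funext fun U => descendTo_self F ℰp j U
    rw [e, Measure.map_id, hν1, gibbsK_eq]
  | succ d ih =>
    intro j hjK hj
    have hjK' : j + 1 ≤ K := by omega
    have hd : Measurable (descend F ℰp j : GaugeField (F.P (j + 1)) 0 ↥(Matrix.specialUnitaryGroup (Fin 2) ℂ) →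
        GaugeField (F.P j) 0 ↥(Matrix.specialUnitaryGroup (Fin 2) ℂ)) := measurable_descend F ℰp measurableE_ℰp j
    have hD : Measurable (descendTo F ℰp (j + 1) K hjK' : GaugeField (F.P K) 0 ↥(Matrix.specialUnitaryGroup (Fin 2) ℂ) →
        GaugeField (F.P (j + 1)) 0 ↥(Matrix.specialUnitaryGroup (Fin 2) ℂ)) := measurable_descendTo F ℰp measurableE_ℰp hjK'
    have e : (descendTo F ℰp j K hjK : GaugeField (F.P K) 0 ↥(Matrix.specialUnitaryGroup (Fin 2) ℂ) →
        GaugeField (F.P j) 0 ↥(Matrix.specialUnitaryGroup (Fin 2) ℂ)) = descend F ℰp j ∘ descendTo F ℰp (j + 1) K hjK' := by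
      funext U
      show descendTo F ℰp j K hjK U = descend F ℰp j (descendTo F ℰp (j + 1) K hjK' U)
      rw [descend_eq_descendTo' F j (Nat.le_succ j), descendTo_descendTo]
    rw [hν2 K j (by omega), ih (j + 1) hjK' (by omega), Measure.map_map hd hD, e]

/-- ★★ **(w) AT THE UNCUT HEIGHTS, BY NAME**: `ν K j = dU_j.withDensity (ofReal (Z_K⁻¹ · heightDensity F γ hjK univ))` — the run law at height `j` HAS the density
`Z_K⁻¹ ρ_{K−j}` (Bałaban's renormalised density of run `K`, lit `T3TiltDescent.heightDensity` at `S = univ`, read on the `j`-th tower) with respect to product Haar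
(lit ✓`map_descendTo_restrict_eq_withDensity`; `γ ≥ 0`). [cite: Balaban1985UV3, (2) p.256] -/
theorem run_eq_withDensity_heightDensity_univ (hγ : 0 ≤ γ)
    (ν : ℕ → (j : ℕ) → Measure (GaugeField (F.P j) 0 ↥(Matrix.specialUnitaryGroup (Fin 2) ℂ)))
    (hν1 : ∀ K, ν K K = T4GenFunBounds.gibbsMeasure (F.P K) ((F.scheme ℰp γ).β K))
    (hν2 : ∀ K j, j < K → ν K j = Measure.map (descend F ℰp j) (ν K (j + 1)))
    {j K : ℕ} (hjK : j ≤ K) :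
    ν K j = (fieldMeasure (F.P j) 0 ↥(Matrix.specialUnitaryGroup (Fin 2) ℂ)).withDensity (fun V => ENNReal.ofReal
      ((partitionFn (G := ↥(Matrix.specialUnitaryGroup (Fin 2) ℂ)) (F.P K) ((F.scheme ℰp γ).β K))⁻¹ *
        heightDensity F γ hjK Set.univ V)) := by
  rw [run_eq_map_descendTo F ν hν1 hν2 hjK, ← map_descendTo_restrict_eq_withDensity F hjK MeasurableSet.univ hγ, Measure.restrict_univ]

/-- The run laws are probability measures (`γ ≥ 0`). [cite: Balaban1985UV3, (2) p.256] -/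
theorem isProbabilityMeasure_run (hγ : 0 ≤ γ)
    (ν : ℕ → (j : ℕ) → Measure (GaugeField (F.P j) 0 ↥(Matrix.specialUnitaryGroup (Fin 2) ℂ)))
    (hν1 : ∀ K, ν K K = T4GenFunBounds.gibbsMeasure (F.P K) ((F.scheme ℰp γ).β K))
    (hν2 : ∀ K j, j < K → ν K j = Measure.map (descend F ℰp j) (ν K (j + 1)))
    {j K : ℕ} (hjK : j ≤ K) : IsProbabilityMeasure (ν K j) := by
  rw [run_eq_map_descendTo F ν hν1 hν2 hjK]
  haveI := isProbabilityMeasure_gibbsK F ℰp hγ K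
  exact Measure.isProbabilityMeasure_map (measurable_descendTo F ℰp measurableE_ℰp hjK).aemeasurable

/-- The run laws are absolutely continuous with respect to product Haar (✓(L16) `absolutelyContinuous_map_descendTo`; `γ ≥ 0`). [cite: Balaban1985Averaging, (10) p.19] -/
theorem run_absolutelyContinuous (hγ : 0 ≤ γ)
    (ν : ℕ → (j : ℕ) → Measure (GaugeField (F.P j) 0 ↥(Matrix.specialUnitaryGroup (Fin 2) ℂ)))
    (hν1 : ∀ K, ν K K = T4GenFunBounds.gibbsMeasure (F.P K) ((F.scheme ℰp γ).β K))
    (hν2 : ∀ K j, j < K → ν K j = Measure.map (descend F ℰp j) (ν K (j + 1)))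
    {j K : ℕ} (hjK : j ≤ K) :
    ν K j ≪ fieldMeasure (F.P j) 0 ↥(Matrix.specialUnitaryGroup (Fin 2) ℂ) := by
  rw [run_eq_withDensity_heightDensity_univ F hγ ν hν1 hν2 hjK]
  exact withDensity_absolutelyContinuous _ _

end Runs

/-! ## §2 The cut tower is sandwiched: `(descendTo j K)_*(Gibbs_K|E) ≤ μ j ≤ ν K j` -/

section Tower

variable (F : T3Family) {γ : ℝ}
  (χ : (i : ℕ) → GaugeField (F.P i) 0 ↥(Matrix.specialUnitaryGroup (Fin 2) ℂ) → ℝ≥0∞)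
  (ν : ℕ → (j : ℕ) → Measure (GaugeField (F.P j) 0 ↥(Matrix.specialUnitaryGroup (Fin 2) ℂ)))
  {K Ts : ℕ}
  (μ : (j : ℕ) → Measure (GaugeField (F.P j) 0 ↥(Matrix.specialUnitaryGroup (Fin 2) ℂ)))

/-- ★ **THE CUT TOWER LIES BELOW THE RUN**: `μ j ≤ ν K j` for every `j` (weights `χ ≤ 1`; the importable twin of the line's internal bookkeeping
`SFTower.sfTower_le_and_deficit` (1)). [cite: Balaban1985UV3, (7) p.257] -/
theorem tower_le_run (hχ1 : ∀ i U, χ i U ≤ 1)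
    (hν2 : ∀ K j, j < K → ν K j = Measure.map (descend F ℰp j) (ν K (j + 1)))
    (hTs : Ts ≤ K)
    (hanch : ∀ j, Ts ≤ j → μ j = ν K j)
    (hcut : ∀ j, j < Ts → μ j = Measure.map (descend F ℰp j) ((μ (j + 1)).withDensity (χ (j + 1)))) :
    ∀ j, μ j ≤ ν K j := by
  have hwd : ∀ (k : ℕ) (m : Measure (GaugeField (F.P k) 0 ↥(Matrix.specialUnitaryGroup (Fin 2) ℂ))), m.withDensity (χ k) ≤ m := fun k m =>
    (withDensity_mono (Eventually.of_forall (hχ1 k))).trans_eq (by simp)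
  suffices h : ∀ n j, j + n = Ts → μ j ≤ ν K j by
    intro j
    rcases le_or_gt Ts j with hj | hj
    · exact (hanch j hj).le
    · exact h (Ts - j) j (by omega)
  intro n
  induction n with
  | zero =>
    intro j hj
    rw [add_zero] at hj
    exact (hanch j hj.ge).le
  | succ n ih =>
    intro j hj
    have hjT : j < Ts := by omega
    have hd : Measurable (descend F ℰp j : GaugeField (F.P (j + 1)) 0 ↥(Matrix.specialUnitaryGroup (Fin 2) ℂ) →
        GaugeField (F.P j) 0 ↥(Matrix.specialUnitaryGroup (Fin 2) ℂ)) := measurable_descend F ℰp measurableE_ℰp j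
    rw [hcut j hjT, hν2 K j (by omega)]
    exact Measure.map_mono (((hwd _ _).trans (ih (j + 1) (by omega)))) hd

/-- ★★ **THE CUT TOWER LIES ABOVE EVERY DESCENDED RESTRICTED GIBBS MEASURE WHOSE RESTRICTION SET SITS ON THE PLATEAU**: for a measurable set `E` of run
`K`'s finest fields on which every cut weight met on the way down equals one — `χ i (descendTo F ℰp i K U) = 1` for `U ∈ E`, `j < i ≤ Ts` — one has
`(descendTo F ℰp j K)_*(Gibbs_K|E) ≤ μ j` (downward induction: `withDensity` of a weight `= 1` on `E`, monotonicity of `withDensity` and `map`, ✓`descend ∘ descendTo =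
descendTo`). [cite: Balaban1985UV3, (7) p.257 and (47) p.267] -/
theorem map_restrict_le_tower (hχm : ∀ i, Measurable (χ i))
    (hν1 : ∀ K, ν K K = T4GenFunBounds.gibbsMeasure (F.P K) ((F.scheme ℰp γ).β K))
    (hν2 : ∀ K j, j < K → ν K j = Measure.map (descend F ℰp j) (ν K (j + 1)))
    (hTs : Ts ≤ K)
    (hanch : ∀ j, Ts ≤ j → μ j = ν K j)
    (hcut : ∀ j, j < Ts → μ j = Measure.map (descend F ℰp j) ((μ (j + 1)).withDensity (χ (j + 1))))
    {E : Set (GaugeField (F.P K) 0 ↥(Matrix.specialUnitaryGroup (Fin 2) ℂ))} (hE : MeasurableSet E)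
    {j : ℕ} (hjK : j ≤ K)
    (hE1 : ∀ U ∈ E, ∀ (i : ℕ) (_ : j < i) (hiT : i ≤ Ts), χ i (descendTo F ℰp i K (hiT.trans hTs) U) = 1) :
    Measure.map (descendTo F ℰp j K hjK) ((gibbsK F ℰp γ K).restrict E) ≤ μ j := by
  -- at and above the seed height: the restricted descended law is below the full one, which IS `μ j`
  have htop : ∀ (j : ℕ) (hjK : j ≤ K), Ts ≤ j → Measure.map (descendTo F ℰp j K hjK) ((gibbsK F ℰp γ K).restrict E) ≤ μ j := by
    intro j hjK hj
    rw [hanch j hj, run_eq_map_descendTo F ν hν1 hν2 hjK]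
    exact Measure.map_mono Measure.restrict_le_self (measurable_descendTo F ℰp measurableE_ℰp hjK)
  -- below it: downward induction on `n = Ts − j`
  suffices h : ∀ (n j : ℕ) (hjK : j ≤ K), j + n = Ts →
      (∀ U ∈ E, ∀ (i : ℕ) (_ : j < i) (hiT : i ≤ Ts), χ i (descendTo F ℰp i K (hiT.trans hTs) U) = 1) →
      Measure.map (descendTo F ℰp j K hjK) ((gibbsK F ℰp γ K).restrict E) ≤ μ j by
    rcases le_or_gt Ts j with hj | hj
    · exact htop j hjK hj
    · exact h (Ts - j) j hjK (by omega) hE1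
  intro n
  induction n with
  | zero =>
    intro j hjK hj _
    rw [add_zero] at hj
    exact htop j hjK hj.ge
  | succ n ih =>
    intro j hjK hj hE1
    have hjT : j < Ts := by omega
    have hjK' : j + 1 ≤ K := by omega
    have hd : Measurable (descend F ℰp j : GaugeField (F.P (j + 1)) 0 ↥(Matrix.specialUnitaryGroup (Fin 2) ℂ) →
        GaugeField (F.P j) 0 ↥(Matrix.specialUnitaryGroup (Fin 2) ℂ)) := measurable_descend F ℰp measurableE_ℰp j
    have hD : Measurable (descendTo F ℰp (j + 1) K hjK' : GaugeField (F.P K) 0 ↥(Matrix.specialUnitaryGroup (Fin 2) ℂ) →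
        GaugeField (F.P (j + 1)) 0 ↥(Matrix.specialUnitaryGroup (Fin 2) ℂ)) := measurable_descendTo F ℰp measurableE_ℰp hjK'
    -- induction hypothesis one level up
    have hIH : Measure.map (descendTo F ℰp (j + 1) K hjK') ((gibbsK F ℰp γ K).restrict E) ≤ μ (j + 1) :=
      ih (j + 1) hjK' (by omega) fun U hU i hi hiT => hE1 U hU i (by omega) hiT
    -- the weight `χ (j+1)` is `1` on the image of `E`
    have hone : ∀ U ∈ E, χ (j + 1) (descendTo F ℰp (j + 1) K hjK' U) = 1 := fun U hU => hE1 U hU (j + 1) (by omega) (by omega)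
    have hwd : (Measure.map (descendTo F ℰp (j + 1) K hjK') ((gibbsK F ℰp γ K).restrict E)).withDensity (χ (j + 1)) =
        Measure.map (descendTo F ℰp (j + 1) K hjK') ((gibbsK F ℰp γ K).restrict E) := by
      rw [← map_withDensity_comp_eq hD (hχm (j + 1)), restrict_withDensity_eq_restrict_of_eq_one hE hone]
    -- `descend j ∘ descendTo (j+1) K = descendTo j K`
    have e : (descendTo F ℰp j K hjK : GaugeField (F.P K) 0 ↥(Matrix.specialUnitaryGroup (Fin 2) ℂ) →
        GaugeField (F.P j) 0 ↥(Matrix.specialUnitaryGroup (Fin 2) ℂ)) = descend F ℰp j ∘ descendTo F ℰp (j + 1) K hjK' := by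
      funext U
      show descendTo F ℰp j K hjK U = descend F ℰp j (descendTo F ℰp (j + 1) K hjK' U)
      rw [descend_eq_descendTo' F j (Nat.le_succ j), descendTo_descendTo]
    rw [hcut j hjT, e, ← Measure.map_map hd hD, ← hwd]
    exact Measure.map_mono (withDensity_mono_measure hIH _) hd

/-- ★★ **THE SAME IN THE NAMED CURRENCY**: `dU_j.withDensity (ofReal (Z_K⁻¹ · heightDensity F γ hjK E)) ≤ μ j` — the cut tower's law dominates the law with density
`Z_K⁻¹ ρ^{E}_{K−j}`, Bałaban's `E`-RESTRICTED renormalised density of run `K` read at height `j` (lit ✓`map_descendTo_restrict_eq_withDensity`; `γ ≥ 0`).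
[cite: Balaban1985UV3, (2) p.256 and (47) p.267] -/
theorem withDensity_heightDensity_le_tower (hγ : 0 ≤ γ) (hχm : ∀ i, Measurable (χ i))
    (hν1 : ∀ K, ν K K = T4GenFunBounds.gibbsMeasure (F.P K) ((F.scheme ℰp γ).β K))
    (hν2 : ∀ K j, j < K → ν K j = Measure.map (descend F ℰp j) (ν K (j + 1)))
    (hTs : Ts ≤ K)
    (hanch : ∀ j, Ts ≤ j → μ j = ν K j)
    (hcut : ∀ j, j < Ts → μ j = Measure.map (descend F ℰp j) ((μ (j + 1)).withDensity (χ (j + 1))))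
    {E : Set (GaugeField (F.P K) 0 ↥(Matrix.specialUnitaryGroup (Fin 2) ℂ))} (hE : MeasurableSet E)
    {j : ℕ} (hjK : j ≤ K)
    (hE1 : ∀ U ∈ E, ∀ (i : ℕ) (_ : j < i) (hiT : i ≤ Ts), χ i (descendTo F ℰp i K (hiT.trans hTs) U) = 1) :
    (fieldMeasure (F.P j) 0 ↥(Matrix.specialUnitaryGroup (Fin 2) ℂ)).withDensity (fun V => ENNReal.ofReal
      ((partitionFn (G := ↥(Matrix.specialUnitaryGroup (Fin 2) ℂ)) (F.P K) ((F.scheme ℰp γ).β K))⁻¹ * heightDensity F γ hjK E V)) ≤ μ j := by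
  rw [← map_descendTo_restrict_eq_withDensity F hjK hE hγ]
  exact map_restrict_le_tower F χ ν μ hχm hν1 hν2 hTs hanch hcut hE hjK hE1

/-- ★ **(w) FOR THE CUT HEIGHTS, EXISTENCE**: every law of the cut tower is absolutely continuous with respect to product Haar (it lies below the run law, §1).
[cite: Balaban1985Averaging, (10) p.19] -/
theorem tower_absolutelyContinuous (hγ : 0 ≤ γ) (hχ1 : ∀ i U, χ i U ≤ 1)
    (hν1 : ∀ K, ν K K = T4GenFunBounds.gibbsMeasure (F.P K) ((F.scheme ℰp γ).β K))
    (hν2 : ∀ K j, j < K → ν K j = Measure.map (descend F ℰp j) (ν K (j + 1)))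
    (hTs : Ts ≤ K)
    (hanch : ∀ j, Ts ≤ j → μ j = ν K j)
    (hcut : ∀ j, j < Ts → μ j = Measure.map (descend F ℰp j) ((μ (j + 1)).withDensity (χ (j + 1))))
    {j : ℕ} (hjK : j ≤ K) :
    μ j ≪ fieldMeasure (F.P j) 0 ↥(Matrix.specialUnitaryGroup (Fin 2) ℂ) :=
  (Measure.absolutelyContinuous_of_le (tower_le_run F χ ν μ hχ1 hν2 hTs hanch hcut j)).trans
    (run_absolutelyContinuous F hγ ν hν1 hν2 hjK)

/-- The cut tower's laws are finite, of mass `≤ 1` (`γ ≥ 0`). [cite: Balaban1985UV3, (7) p.257] -/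
theorem isFiniteMeasure_tower (hγ : 0 ≤ γ) (hχ1 : ∀ i U, χ i U ≤ 1)
    (hν1 : ∀ K, ν K K = T4GenFunBounds.gibbsMeasure (F.P K) ((F.scheme ℰp γ).β K))
    (hν2 : ∀ K j, j < K → ν K j = Measure.map (descend F ℰp j) (ν K (j + 1)))
    (hTs : Ts ≤ K)
    (hanch : ∀ j, Ts ≤ j → μ j = ν K j)
    (hcut : ∀ j, j < Ts → μ j = Measure.map (descend F ℰp j) ((μ (j + 1)).withDensity (χ (j + 1))))
    {j : ℕ} (hjK : j ≤ K) : IsFiniteMeasure (μ j) := by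
  haveI := isProbabilityMeasure_run F hγ ν hν1 hν2 hjK
  exact isFiniteMeasure_of_le (ν K j) (tower_le_run F χ ν μ hχ1 hν2 hTs hanch hcut j)

end Tower

/-! ## §3 In the named currency: the a.e. density sandwich, and (p) ∧ (w) for ONE version via WREG -/

section Named

variable (F : T3Family) {γ : ℝ}
  (χ : (i : ℕ) → GaugeField (F.P i) 0 ↥(Matrix.specialUnitaryGroup (Fin 2) ℂ) → ℝ≥0∞)
  (ν : ℕ → (j : ℕ) → Measure (GaugeField (F.P j) 0 ↥(Matrix.specialUnitaryGroup (Fin 2) ℂ)))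
  {K Ts : ℕ}
  (μ : (j : ℕ) → Measure (GaugeField (F.P j) 0 ↥(Matrix.specialUnitaryGroup (Fin 2) ℂ)))

/-- **GOOD HISTORIES SIT ON THE PLATEAU**: if every cut weight above height `j` equals one on its `θ′`-window (`PlaqSmall (θ′ i) U → χ i U = 1`, `j < i ≤ Ts`), then on
`histGood F ℰp θ′ K j` every cut weight met on the way down from run `K` equals one (✓`histGood_iff_descendTo`). [cite: Balaban1985UV3, (7) p.257] -/
theorem histGood_plateau (hTs : Ts ≤ K) {θ' : ℕ → ℝ} {j : ℕ}
    (hplat : ∀ (i : ℕ), j < i → i ≤ Ts → ∀ U, PlaqSmall (θ' i) U → χ i U = 1) :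
    ∀ U ∈ histGood F ℰp θ' K j, ∀ (i : ℕ) (_ : j < i) (hiT : i ≤ Ts), χ i (descendTo F ℰp i K (hiT.trans hTs) U) = 1 :=
  fun U hU i hji hiT => hplat i hji hiT (descendTo F ℰp i K (hiT.trans hTs) U) ((histGood_iff_descendTo F).mp hU i hji.le (hiT.trans hTs))

/-- ★★★ **(m3) AS A SENTENCE — THE A.E. DENSITY SANDWICH**: under the plateau hypothesis, EVERY density `f` of the cut tower's law `μ j` (`μ j = dU_j.withDensity f`,
`f` measurable) satisfies `ofReal (Z_K⁻¹·ρ^{histGood θ′}_{K−j}) ≤ f ≤ ofReal (Z_K⁻¹·ρ_{K−j})` `dU_j`-a.e.: a (47)-type LOWER bound for the `histGood`-RESTRICTED renormalised density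
of run `K` (print's object — the derivation of (47) restricts every level by `χ_i`, p.267) and a (41)-type UPPER bound for the FULL one both transfer a.e. to the cut tower.
[cite: Balaban1985UV3, (41) p.266 and (47) p.267] -/
theorem density_sandwich_ae (hγ : 0 ≤ γ) (hχm : ∀ i, Measurable (χ i)) (hχ1 : ∀ i U, χ i U ≤ 1)
    (hν1 : ∀ K, ν K K = T4GenFunBounds.gibbsMeasure (F.P K) ((F.scheme ℰp γ).β K))
    (hν2 : ∀ K j, j < K → ν K j = Measure.map (descend F ℰp j) (ν K (j + 1)))
    (hTs : Ts ≤ K)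
    (hanch : ∀ j, Ts ≤ j → μ j = ν K j)
    (hcut : ∀ j, j < Ts → μ j = Measure.map (descend F ℰp j) ((μ (j + 1)).withDensity (χ (j + 1))))
    {θ' : ℕ → ℝ} {j : ℕ} (hjK : j ≤ K)
    (hplat : ∀ (i : ℕ), j < i → i ≤ Ts → ∀ U, PlaqSmall (θ' i) U → χ i U = 1)
    {f : GaugeField (F.P j) 0 ↥(Matrix.specialUnitaryGroup (Fin 2) ℂ) → ℝ≥0∞} (hf : Measurable f)
    (hμf : μ j = (fieldMeasure (F.P j) 0 ↥(Matrix.specialUnitaryGroup (Fin 2) ℂ)).withDensity f) :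
    (fun V => ENNReal.ofReal ((partitionFn (G := ↥(Matrix.specialUnitaryGroup (Fin 2) ℂ)) (F.P K) ((F.scheme ℰp γ).β K))⁻¹ *
        heightDensity F γ hjK (histGood F ℰp θ' K j) V)) ≤ᵐ[fieldMeasure (F.P j) 0 ↥(Matrix.specialUnitaryGroup (Fin 2) ℂ)] f ∧
      f ≤ᵐ[fieldMeasure (F.P j) 0 ↥(Matrix.specialUnitaryGroup (Fin 2) ℂ)] (fun V => ENNReal.ofReal
        ((partitionFn (G := ↥(Matrix.specialUnitaryGroup (Fin 2) ℂ)) (F.P K) ((F.scheme ℰp γ).β K))⁻¹ * heightDensity F γ hjK Set.univ V)) := by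
  have hEm : MeasurableSet (histGood F ℰp θ' K j) := measurableSet_histGood F ℰp measurableE_ℰp θ' K j
  refine ⟨?_, ?_⟩
  · have hle := withDensity_heightDensity_le_tower F χ ν μ hγ hχm hν1 hν2 hTs hanch hcut hEm hjK (histGood_plateau F χ hTs hplat)
    rw [hμf] at hle
    exact ae_le_of_withDensity_le (ENNReal.measurable_ofReal.comp ((heightDensity_props F hjK hEm hγ).1.const_mul _)) hle
  · have hle := tower_le_run F χ ν μ hχ1 hν2 hTs hanch hcut j
    rw [hμf, run_eq_withDensity_heightDensity_univ F hγ ν hν1 hν2 hjK] at hle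
    exact ae_le_of_withDensity_le hf hle

end Named

end Summit.QuantumFields.YangMills.Theorems.FluctuationComparisonRegPrIntLS1aTowerLawSandwich

end
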